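import Summits.ResolutionOfSingularities.ResolutionOfSingularities.Theorems.FrobeniusClosingSteerBetaNewtonSupport
import Summits.ResolutionOfSingularities.ResolutionOfSingularities.Theorems.FrobeniusClosingSteerBetaPolygonMoves
import HarnessLib

/-!
# Crux `Steer` (stmt-ResolutionOfSingularities-16345), chain W4.1, β-LEAF, K-β2♭ part (II), file 5: VERTEX monomials and
# FRAME MOVES modulo the strict `β`-ideal (def-free)

OURS (campaign `res-hironaka`, rung L ★L-G4, slot W4.1; statements about the route's own objects; they replace the
role of no printed item and are NOT statements of the manuscript under review [claim: Hironaka2017, status: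
under-review]; AI review is weaker than expert review). Seat res-D-pv-003 (gen 7), K-β2♭ kernel owner.

* `betaGtCond_vertex_add_single`, **`mul_uPow_vertex_mem_betaGtIdeal`** — `𝔪 · t^a ⊆ BetaGt (α, β)` for a VERTEX exponent
  `a = (αm, βm, i, j)` (`α, β ≥ 0`, `α + β ≥ 1`): a vertex monomial times a non-unit lies strictly beyond the vertex.
* `span_four_move_eq` — moving `z, w` by elements of `(x, y)` keeps `(x, y, z, w)`.
* `generator_mul_pow_mul_mem_betaStrict`, `maximalIdeal_mul_pow_mul_mem_betaStrict` — `𝔪 · M^s · z^i w^j ⊆ I⁺(z, w)` for the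
  monomial `M = x^a y^b` of an INTEGRAL vertex (`a + b ≥ 1`, `s ≥ 1`, `i + j + s = d`), `I⁺` = res-L0-w41-stub-4's strict `β`-ideal.
* **`betaGt_move_maximalIdeal_iff`** — moves `z ↦ z + ε₁ M`, `w ↦ w + ε₂ M` with `ε₁, ε₂ ∈ 𝔪` do not change `BetaGt (a, b)`
  (`betaStrict_eq_of_move` + `sup_iSup_eq_of_move` with the filtration `(𝔪 · M)^s`). Used by the (II-Y) transfer to replace a
  downstairs move constant by the image of an upstairs lift with the same residue.

[cite: CossartPiltant2019, Prop. 2.1] [cite: CossartJannsenSaito2020, Lemma 12.2] No Theses file is imported; nothing here is a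
route item or a registration.
-/

noncomputable section

-- `Summit.<S>.<S>.…` duplicates the summit name by design (single-problem summit).
set_option linter.dupNamespace false

namespace Summit.ResolutionOfSingularities.ResolutionOfSingularities.Theorems.SwitchingDichotomy.BetaNewton

open IsLocalRing
open Literature.AlgebraicGeometry.Resolution
open Literature.AlgebraicGeometry.Resolution.CossartPiltant (uPow uPow_add uPow_single)
open Summit.ResolutionOfSingularities.ResolutionOfSingularities.Theorems.SwitchingDichotomy.BetaPolygon
open Summit.ResolutionOfSingularities.ResolutionOfSingularities.Theorems.SwitchingDichotomy.BetaPolygonMoves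
  (betaGt_iff_mem_sup_betaStrict betaStrict_eq_of_move sup_iSup_eq_of_move)
open Summit.ResolutionOfSingularities.ResolutionOfSingularities.Theorems.SwitchingDichotomy.BetaLetter (range_four)

variable {S S₁ : Type} [CommRing S] [CommRing S₁]

/-! ## §1 `𝔪 · (vertex monomial) ⊆ BetaGt` -/

/-- The strict `β`-condition one step beyond a VERTEX exponent `a = (αm, βm, i, j)` (`m = d − i − j`, `α, β ≥ 0`, `α + β ≥ 1`):
each of `a + e₀`, `a + e₁`, `a + e₂`, `a + e₃` satisfies the `BetaGt (α, β)` exponent condition. [folklore] -/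
theorem betaGtCond_vertex_add_single {d : ℕ} {α β : ℚ} (hα : 0 ≤ α) (hβ : 0 ≤ β) (hαβ : 1 ≤ α + β)
    {a : Fin 4 → ℕ} (hzw : a 2 + a 3 < d) (ha0 : (a 0 : ℚ) = α * ((d - a 2 - a 3 : ℕ) : ℚ))
    (ha1 : (a 1 : ℚ) = β * ((d - a 2 - a 3 : ℕ) : ℚ)) (l : Fin 4) :
    d ≤ ((a + Pi.single l 1 : Fin 4 → ℕ)) 2 + ((a + Pi.single l 1 : Fin 4 → ℕ)) 3 ∨
      ⌊α * ((d - ((a + Pi.single l 1 : Fin 4 → ℕ)) 2 - ((a + Pi.single l 1 : Fin 4 → ℕ)) 3 : ℕ) : ℚ)⌋₊ + 1 ≤ ((a + Pi.single l 1 : Fin 4 → ℕ)) 0 ∨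
      (⌈α * ((d - ((a + Pi.single l 1 : Fin 4 → ℕ)) 2 - ((a + Pi.single l 1 : Fin 4 → ℕ)) 3 : ℕ) : ℚ)⌉₊ ≤ ((a + Pi.single l 1 : Fin 4 → ℕ)) 0 ∧
        ⌊β * ((d - ((a + Pi.single l 1 : Fin 4 → ℕ)) 2 - ((a + Pi.single l 1 : Fin 4 → ℕ)) 3 : ℕ) : ℚ)⌋₊ + 1 ≤ ((a + Pi.single l 1 : Fin 4 → ℕ)) 1) := by
  set n : ℕ := d - a 2 - a 3 with hn
  have hn1 : 1 ≤ n := by omega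
  have hfl0 : ⌊α * (n : ℚ)⌋₊ = a 0 := by rw [← ha0, Nat.floor_natCast]
  have hce0 : ⌈α * (n : ℚ)⌉₊ = a 0 := by rw [← ha0, Nat.ceil_natCast]
  have hfl1 : ⌊β * (n : ℚ)⌋₊ = a 1 := by rw [← ha1, Nat.floor_natCast]
  -- the two `z`/`w` cases share one computation
  have hzwcase : ∀ n' : ℕ, n' + 1 = n →
      ⌊α * (n' : ℚ)⌋₊ + 1 ≤ a 0 ∨ (⌈α * (n' : ℚ)⌉₊ ≤ a 0 ∧ ⌊β * (n' : ℚ)⌋₊ + 1 ≤ a 1) := by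
    intro n' hn'
    have hcast : (n : ℚ) = n' + 1 := by rw [← hn']; push_cast; ring
    rcases eq_or_lt_of_le hα with hα0 | hαpos
    · -- `α = 0`: `a₀ = 0`, `β ≥ 1`
      right
      have hβ1 : (1 : ℚ) ≤ β := by linarith
      refine ⟨?_, ?_⟩
      · rw [← hα0, zero_mul, Nat.ceil_zero]; exact Nat.zero_le _
      · have hlt : β * (n' : ℚ) < a 1 := by rw [ha1, hcast]; nlinarith
        exact Nat.succ_le_of_lt ((Nat.floor_lt (mul_nonneg hβ (Nat.cast_nonneg n'))).mpr hlt)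
    · left
      have hlt : α * (n' : ℚ) < a 0 := by rw [ha0, hcast]; nlinarith
      exact Nat.succ_le_of_lt ((Nat.floor_lt (mul_nonneg hα (Nat.cast_nonneg n'))).mpr hlt)
  obtain rfl | rfl | rfl | rfl : l = 0 ∨ l = 1 ∨ l = 2 ∨ l = 3 := by fin_cases l <;> simp
  · -- `x`
    right; left
    simp only [Pi.add_apply, Pi.single_eq_same,
      Pi.single_eq_of_ne (show (2 : Fin 4) ≠ 0 by decide), Pi.single_eq_of_ne (show (3 : Fin 4) ≠ 0 by decide), add_zero]
    rw [hfl0]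
  · -- `y`
    right; right
    simp only [Pi.add_apply, Pi.single_eq_same, Pi.single_eq_of_ne (show (0 : Fin 4) ≠ 1 by decide),
      Pi.single_eq_of_ne (show (2 : Fin 4) ≠ 1 by decide), Pi.single_eq_of_ne (show (3 : Fin 4) ≠ 1 by decide), add_zero]
    rw [hce0, hfl1]
    exact ⟨le_rfl, le_rfl⟩
  · -- `z`
    simp only [Pi.add_apply, Pi.single_eq_same, Pi.single_eq_of_ne (show (0 : Fin 4) ≠ 2 by decide),
      Pi.single_eq_of_ne (show (1 : Fin 4) ≠ 2 by decide), Pi.single_eq_of_ne (show (3 : Fin 4) ≠ 2 by decide), add_zero]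
    by_cases hd : d ≤ a 2 + 1 + a 3
    · exact Or.inl hd
    · right
      rw [show d - (a 2 + 1) - a 3 = n - 1 by omega]
      exact hzwcase (n - 1) (by omega)
  · -- `w`
    simp only [Pi.add_apply, Pi.single_eq_same, Pi.single_eq_of_ne (show (0 : Fin 4) ≠ 3 by decide),
      Pi.single_eq_of_ne (show (1 : Fin 4) ≠ 3 by decide), Pi.single_eq_of_ne (show (2 : Fin 4) ≠ 3 by decide), add_zero]
    by_cases hd : d ≤ a 2 + (a 3 + 1)
    · exact Or.inl hd
    · right
      rw [show d - a 2 - (a 3 + 1) = n - 1 by omega]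
      exact hzwcase (n - 1) (by omega)

/-- **`𝔪 · t^a ⊆ BetaGt (α, β)`** for a vertex exponent `a = (αm, βm, i, j)` (`α, β ≥ 0`, `α + β ≥ 1`): a vertex monomial times a
non-unit lies strictly beyond the vertex. [folklore] -/
theorem mul_uPow_vertex_mem_betaGtIdeal [IsLocalRing S] {x y z w : S} (hspan : Ideal.span {x, y, z, w} = maximalIdeal S)
    {d : ℕ} {α β : ℚ} (hα : 0 ≤ α) (hβ : 0 ≤ β) (hαβ : 1 ≤ α + β) {a : Fin 4 → ℕ} (hzw : a 2 + a 3 < d)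
    (ha0 : (a 0 : ℚ) = α * ((d - a 2 - a 3 : ℕ) : ℚ)) (ha1 : (a 1 : ℚ) = β * ((d - a 2 - a 3 : ℕ) : ℚ))
    {s : S} (hs : s ∈ maximalIdeal S) :
    s * uPow ![x, y, z, w] a ∈ Ideal.span {z, w} ^ d ⊔
      ⨆ (i : ℕ) (j : ℕ) (_ : i + j < d),
        (Ideal.span {x ^ (⌊α * ((d - i - j : ℕ) : ℚ)⌋₊ + 1) * z ^ i * w ^ j} ⊔
          Ideal.span {x ^ ⌈α * ((d - i - j : ℕ) : ℚ)⌉₊ * y ^ (⌊β * ((d - i - j : ℕ) : ℚ)⌋₊ + 1) * z ^ i * w ^ j}) := by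
  rw [← hspan, ← range_four] at hs
  obtain ⟨cf, rfl⟩ := Ideal.mem_span_range_iff_exists_fun.mp hs
  rw [Finset.sum_mul]
  refine Ideal.sum_mem _ fun l _ => ?_
  rw [mul_assoc, ← uPow_single ![x, y, z, w] l, ← uPow_add, add_comm (Pi.single l 1)]
  exact Ideal.mul_mem_left _ _
    (uPow_mem_betaGtIdeal x y z w d α β (betaGtCond_vertex_add_single hα hβ hαβ hzw ha0 ha1 l))

/-! ## §2 Moves by `𝔪 · M` at an integral vertex do not change `BetaGt` -/

/-- Moving `z, w` by elements of `(x, y)` does not change the ideal `(x, y, z, w)`. [folklore] -/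
theorem span_four_move_eq (x y z w : S) {δ₁ δ₂ : S} (h₁ : δ₁ ∈ Ideal.span ({x, y} : Set S))
    (h₂ : δ₂ ∈ Ideal.span ({x, y} : Set S)) :
    Ideal.span ({x, y, z + δ₁, w + δ₂} : Set S) = Ideal.span {x, y, z, w} := by
  have hxy : ∀ z w : S, Ideal.span ({x, y} : Set S) ≤ Ideal.span {x, y, z, w} := fun z w =>
    Ideal.span_mono (by intro t ht; simp only [Set.mem_insert_iff, Set.mem_singleton_iff] at ht ⊢; tauto)
  have key : ∀ (z w δ₁ δ₂ : S), δ₁ ∈ Ideal.span ({x, y} : Set S) → δ₂ ∈ Ideal.span ({x, y} : Set S) →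
      Ideal.span ({x, y, z + δ₁, w + δ₂} : Set S) ≤ Ideal.span {x, y, z, w} := by
    intro z w δ₁ δ₂ h₁ h₂
    rw [Ideal.span_le]
    intro t ht
    simp only [Set.mem_insert_iff, Set.mem_singleton_iff] at ht
    rcases ht with rfl | rfl | rfl | rfl
    · exact Ideal.subset_span (by simp)
    · exact Ideal.subset_span (by simp)
    · exact add_mem (Ideal.subset_span (by simp)) (hxy z w h₁)
    · exact add_mem (Ideal.subset_span (by simp)) (hxy z w h₂)
  refine le_antisymm (key z w δ₁ δ₂ h₁ h₂) ?_
  have h := key (z + δ₁) (w + δ₂) (-δ₁) (-δ₂) (neg_mem h₁) (neg_mem h₂)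
  simpa only [add_neg_cancel_right] using h

/-- For an INTEGRAL vertex `(a, b)` with `a + b ≥ 1`, `M = x^a y^b`, `s ≥ 1` and `i + j + s = d`: each GENERATOR of `𝔪` times
`M^s · z^i w^j` lies in res-L0-w41-stub-4's STRICT `β`-ideal `I⁺(z, w)` of `(a, b)`. [folklore] -/
theorem generator_mul_pow_mul_mem_betaStrict (x y z w : S) (a b : ℕ) (hab : 1 ≤ a + b) {d s i j : ℕ} (hs : 1 ≤ s)
    (hijs : i + j + s = d) (l : Fin 4) :
    ![x, y, z, w] l * ((x ^ a * y ^ b) ^ s * (z ^ i * w ^ j)) ∈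
      Ideal.span {x, y} * Ideal.span {z, w} ^ d ⊔
        ⨆ (i : ℕ) (j : ℕ) (_ : i + j < d),
          (Ideal.span {x ^ (⌊(a : ℚ) * ((d - i - j : ℕ) : ℚ)⌋₊ + 1)} ⊔
              Ideal.span {x ^ ⌈(a : ℚ) * ((d - i - j : ℕ) : ℚ)⌉₊ * y ^ (⌊(b : ℚ) * ((d - i - j : ℕ) : ℚ)⌋₊ + 1)}) *
            Ideal.span {z ^ i * w ^ j} := by
  -- floor / ceiling of the integral products
  have hfl : ∀ c n : ℕ, ⌊(c : ℚ) * ((n : ℕ) : ℚ)⌋₊ = c * n := fun c n => by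
    rw [show (c : ℚ) * (n : ℚ) = ((c * n : ℕ) : ℚ) by push_cast; ring, Nat.floor_natCast]
  have hce : ∀ c n : ℕ, ⌈(c : ℚ) * ((n : ℕ) : ℚ)⌉₊ = c * n := fun c n => by
    rw [show (c : ℚ) * (n : ℚ) = ((c * n : ℕ) : ℚ) by push_cast; ring, Nat.ceil_natCast]
  obtain ⟨s', rfl⟩ : ∃ s', s = s' + 1 := ⟨s - 1, by omega⟩
  -- membership in the slot cell `C⁺(n) · (z^i' w^j')` from a divisibility
  have hcell : ∀ (i' j' : ℕ) (hlt : i' + j' < d) (v : S),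
      (x ^ (a * (d - i' - j') + 1) ∣ v ∨ x ^ (a * (d - i' - j')) * y ^ (b * (d - i' - j') + 1) ∣ v) →
      v * (z ^ i' * w ^ j') ∈ Ideal.span {x, y} * Ideal.span {z, w} ^ d ⊔
        ⨆ (i : ℕ) (j : ℕ) (_ : i + j < d),
          (Ideal.span {x ^ (⌊(a : ℚ) * ((d - i - j : ℕ) : ℚ)⌋₊ + 1)} ⊔
              Ideal.span {x ^ ⌈(a : ℚ) * ((d - i - j : ℕ) : ℚ)⌉₊ * y ^ (⌊(b : ℚ) * ((d - i - j : ℕ) : ℚ)⌋₊ + 1)}) *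
            Ideal.span {z ^ i * w ^ j} := by
    intro i' j' hlt v hv
    refine Ideal.mem_sup_right (Submodule.mem_iSup_of_mem i' (Submodule.mem_iSup_of_mem j'
      (Submodule.mem_iSup_of_mem hlt (Ideal.mul_mem_mul ?_ (Ideal.mem_span_singleton_self _)))))
    simp only [hfl, hce]
    rcases hv with hv | hv
    · exact Ideal.mem_sup_left (Ideal.mem_span_singleton.mpr hv)
    · exact Ideal.mem_sup_right (Ideal.mem_span_singleton.mpr hv)
  -- membership in `(x, y) · (z, w)^d`
  have htop : ∀ (i' j' : ℕ), d ≤ i' + j' → (x ^ a * y ^ b) ^ (s' + 1) * (z ^ i' * w ^ j') ∈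
      Ideal.span {x, y} * Ideal.span {z, w} ^ d := by
    intro i' j' hle
    refine Ideal.mul_mem_mul ?_ ?_
    · rw [pow_succ]
      refine Ideal.mul_mem_left _ _ ?_
      rcases Nat.eq_zero_or_pos a with ha | ha
      · subst ha
        obtain ⟨b', rfl⟩ : ∃ b', b = b' + 1 := ⟨b - 1, by omega⟩
        rw [pow_zero, one_mul, pow_succ]
        exact Ideal.mul_mem_left _ _ (Ideal.subset_span (by simp))
      · obtain ⟨a', rfl⟩ : ∃ a', a = a' + 1 := ⟨a - 1, by omega⟩
        rw [pow_succ, mul_assoc, mul_comm x, ← mul_assoc]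
        exact Ideal.mul_mem_left _ _ (Ideal.subset_span (by simp))
    · have := Ideal.mul_mem_mul (Ideal.pow_mem_pow (Ideal.subset_span (by simp : z ∈ ({z, w} : Set S))) i')
        (Ideal.pow_mem_pow (Ideal.subset_span (by simp : w ∈ ({z, w} : Set S))) j')
      rw [← pow_add] at this
      exact Ideal.pow_le_pow_right hle this
  -- the `z`/`w` cases: `M^(s'+1) · z^i' w^j'` with `i' + j' + s' = d`
  have hlower : ∀ (i' j' : ℕ), i' + j' + s' = d → (x ^ a * y ^ b) ^ (s' + 1) * (z ^ i' * w ^ j') ∈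
      Ideal.span {x, y} * Ideal.span {z, w} ^ d ⊔
        ⨆ (i : ℕ) (j : ℕ) (_ : i + j < d),
          (Ideal.span {x ^ (⌊(a : ℚ) * ((d - i - j : ℕ) : ℚ)⌋₊ + 1)} ⊔
              Ideal.span {x ^ ⌈(a : ℚ) * ((d - i - j : ℕ) : ℚ)⌉₊ * y ^ (⌊(b : ℚ) * ((d - i - j : ℕ) : ℚ)⌋₊ + 1)}) *
            Ideal.span {z ^ i * w ^ j} := by
    intro i' j' hsum
    by_cases hlt : i' + j' < d
    · refine hcell i' j' hlt _ ?_
      rw [show d - i' - j' = s' by omega]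
      rcases Nat.eq_zero_or_pos a with ha | ha
      · subst ha
        obtain ⟨b', rfl⟩ : ∃ b', b = b' + 1 := ⟨b - 1, by omega⟩
        exact Or.inr ⟨y ^ b', by ring⟩
      · obtain ⟨a', rfl⟩ : ∃ a', a = a' + 1 := ⟨a - 1, by omega⟩
        exact Or.inl ⟨x ^ a' * y ^ (b * (s' + 1)), by ring⟩
    · exact Ideal.mem_sup_left (htop i' j' (by omega))
  have hijlt : i + j < d := by omega
  fin_cases l
  · -- `x`
    show x * ((x ^ a * y ^ b) ^ (s' + 1) * (z ^ i * w ^ j)) ∈ _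
    rw [← mul_assoc]
    refine hcell i j hijlt _ (Or.inl ⟨y ^ (b * (s' + 1)), ?_⟩)
    rw [show d - i - j = s' + 1 by omega]; ring
  · -- `y`
    show y * ((x ^ a * y ^ b) ^ (s' + 1) * (z ^ i * w ^ j)) ∈ _
    rw [← mul_assoc]
    refine hcell i j hijlt _ (Or.inr ⟨1, ?_⟩)
    rw [show d - i - j = s' + 1 by omega]; ring
  · -- `z`
    show z * ((x ^ a * y ^ b) ^ (s' + 1) * (z ^ i * w ^ j)) ∈ _
    rw [show z * ((x ^ a * y ^ b) ^ (s' + 1) * (z ^ i * w ^ j)) = (x ^ a * y ^ b) ^ (s' + 1) * (z ^ (i + 1) * w ^ j) by ring]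
    exact hlower (i + 1) j (by omega)
  · -- `w`
    show w * ((x ^ a * y ^ b) ^ (s' + 1) * (z ^ i * w ^ j)) ∈ _
    rw [show w * ((x ^ a * y ^ b) ^ (s' + 1) * (z ^ i * w ^ j)) = (x ^ a * y ^ b) ^ (s' + 1) * (z ^ i * w ^ (j + 1)) by ring]
    exact hlower i (j + 1) (by omega)

/-- `𝔪 · M^s · z^i w^j ⊆ I⁺(z, w)` at an integral vertex (`a + b ≥ 1`, `s ≥ 1`, `i + j + s = d`). [folklore] -/
theorem maximalIdeal_mul_pow_mul_mem_betaStrict [IsLocalRing S] {x y z w : S}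
    (hspan : Ideal.span {x, y, z, w} = maximalIdeal S) (a b : ℕ) (hab : 1 ≤ a + b) {d s i j : ℕ} (hs : 1 ≤ s)
    (hijs : i + j + s = d) {v : S} (hv : v ∈ maximalIdeal S) :
    v * ((x ^ a * y ^ b) ^ s * (z ^ i * w ^ j)) ∈
      Ideal.span {x, y} * Ideal.span {z, w} ^ d ⊔
        ⨆ (i : ℕ) (j : ℕ) (_ : i + j < d),
          (Ideal.span {x ^ (⌊(a : ℚ) * ((d - i - j : ℕ) : ℚ)⌋₊ + 1)} ⊔
              Ideal.span {x ^ ⌈(a : ℚ) * ((d - i - j : ℕ) : ℚ)⌉₊ * y ^ (⌊(b : ℚ) * ((d - i - j : ℕ) : ℚ)⌋₊ + 1)}) *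
            Ideal.span {z ^ i * w ^ j} := by
  rw [← hspan, ← range_four] at hv
  obtain ⟨cf, rfl⟩ := Ideal.mem_span_range_iff_exists_fun.mp hv
  rw [Finset.sum_mul]
  refine Ideal.sum_mem _ fun l _ => ?_
  rw [mul_assoc]
  exact Ideal.mul_mem_left _ _ (generator_mul_pow_mul_mem_betaStrict x y z w a b hab hs hijs l)

/-- **Moves by `𝔪 · M` at an integral vertex do not change `BetaGt`.** For an integral vertex `(a, b)`, `a + b ≥ 1`,
`M = x^a y^b` and `ε₁, ε₂ ∈ 𝔪`: `BetaGt x y (z + ε₁ M) (w + ε₂ M) d a b g ↔ BetaGt x y z w d a b g`. (res-L0-w41-stub-4's strict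
`β`-ideal is invariant under the move, and `(z', w')^d ≡ (z, w)^d` modulo it.) [folklore] -/
theorem betaGt_move_maximalIdeal_iff [IsLocalRing S] {x y z w : S} (hspan : Ideal.span {x, y, z, w} = maximalIdeal S)
    (a b : ℕ) (hab : 1 ≤ a + b) {ε₁ ε₂ : S} (hε₁ : ε₁ ∈ maximalIdeal S) (hε₂ : ε₂ ∈ maximalIdeal S) (d : ℕ) (g : S) :
    BetaGt x y (z + ε₁ * (x ^ a * y ^ b)) (w + ε₂ * (x ^ a * y ^ b)) d a b g ↔ BetaGt x y z w d a b g := by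
  -- the filtration `C s = (𝔪 · M)^s`
  have hC0 : (fun s : ℕ => (maximalIdeal S * Ideal.span {x ^ a * y ^ b}) ^ s) 0 = ⊤ := by simp
  have hCmul : ∀ s s' : ℕ, (fun s : ℕ => (maximalIdeal S * Ideal.span {x ^ a * y ^ b}) ^ s) s *
      (fun s : ℕ => (maximalIdeal S * Ideal.span {x ^ a * y ^ b}) ^ s) s' ≤
      (fun s : ℕ => (maximalIdeal S * Ideal.span {x ^ a * y ^ b}) ^ s) (s + s') := fun s s' => by
    simp only [← pow_add]; exact le_rfl
  have hφ : ε₁ * (x ^ a * y ^ b) ∈ (fun s : ℕ => (maximalIdeal S * Ideal.span {x ^ a * y ^ b}) ^ s) 1 := by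
    simp only [pow_one]; exact Ideal.mul_mem_mul hε₁ (Ideal.mem_span_singleton_self _)
  have hψ : ε₂ * (x ^ a * y ^ b) ∈ (fun s : ℕ => (maximalIdeal S * Ideal.span {x ^ a * y ^ b}) ^ s) 1 := by
    simp only [pow_one]; exact Ideal.mul_mem_mul hε₂ (Ideal.mem_span_singleton_self _)
  have hT := sup_iSup_eq_of_move hC0 hCmul z w hφ hψ d
  -- the strict ideal is move-invariant
  have hce : ⌈(a : ℚ)⌉₊ = a := Nat.ceil_natCast a
  have hceb : ⌈(b : ℚ)⌉₊ = b := Nat.ceil_natCast b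
  have hmove : ∀ ε : S, ε * (x ^ a * y ^ b) ∈
      Ideal.span {x ^ (⌊(a : ℚ)⌋₊ + 1)} ⊔ Ideal.span {x ^ ⌈(a : ℚ)⌉₊ * y ^ ⌈(b : ℚ)⌉₊} := fun ε => by
    rw [hce, hceb]; exact Ideal.mem_sup_right (Ideal.mem_span_singleton.mpr ⟨ε, by ring⟩)
  have hI := betaStrict_eq_of_move x y z w (Nat.cast_nonneg a) (Nat.cast_nonneg b) (hmove ε₁) (hmove ε₂) d
  -- the `C`-part of each frame lies in the strict ideal of that frame
  have hCle : ∀ z' w' : S, Ideal.span {x, y, z', w'} = maximalIdeal S → (⨆ (i : ℕ) (j : ℕ) (_ : i + j < d),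
      (maximalIdeal S * Ideal.span {x ^ a * y ^ b}) ^ (d - i - j) * Ideal.span {z' ^ i * w' ^ j}) ≤
      Ideal.span {x, y} * Ideal.span {z', w'} ^ d ⊔
        ⨆ (i : ℕ) (j : ℕ) (_ : i + j < d),
          (Ideal.span {x ^ (⌊(a : ℚ) * ((d - i - j : ℕ) : ℚ)⌋₊ + 1)} ⊔
              Ideal.span {x ^ ⌈(a : ℚ) * ((d - i - j : ℕ) : ℚ)⌉₊ * y ^ (⌊(b : ℚ) * ((d - i - j : ℕ) : ℚ)⌋₊ + 1)}) *
            Ideal.span {z' ^ i * w' ^ j} := by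
    intro z' w' hspan'
    refine iSup_le fun i => iSup_le fun j => iSup_le fun hij => ?_
    rw [mul_pow, Ideal.span_singleton_pow, mul_assoc, Ideal.span_singleton_mul_span_singleton, Ideal.mul_le]
    intro r hr c hc
    obtain ⟨c', rfl⟩ := Ideal.mem_span_singleton'.mp hc
    rw [show r * (c' * ((x ^ a * y ^ b) ^ (d - i - j) * (z' ^ i * w' ^ j))) =
      c' * (r * ((x ^ a * y ^ b) ^ (d - i - j) * (z' ^ i * w' ^ j))) by ring]
    refine Ideal.mul_mem_left _ _ ?_
    exact maximalIdeal_mul_pow_mul_mem_betaStrict hspan' a b hab (by omega : 1 ≤ d - i - j) (by omega)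
      (Ideal.pow_le_self (by omega) hr)
  rw [betaGt_iff_mem_sup_betaStrict, betaGt_iff_mem_sup_betaStrict]
  -- both sides equal `T ⊔ I⁺` with `T` the common `C`-threshold ideal
  have key : ∀ (T I J : Ideal S), T ≤ I → J ⊔ I = (J ⊔ T) ⊔ I := fun T I J hle =>
    le_antisymm (sup_le (le_sup_of_le_left le_sup_left) le_sup_right) (sup_le (sup_le le_sup_left (hle.trans le_sup_right))
      le_sup_right)
  have hspan' : Ideal.span {x, y, z + ε₁ * (x ^ a * y ^ b), w + ε₂ * (x ^ a * y ^ b)} = maximalIdeal S := by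
    rw [← hspan]
    have hM : x ^ a * y ^ b ∈ Ideal.span ({x, y} : Set S) := by
      rcases Nat.eq_zero_or_pos a with ha | ha
      · subst ha
        obtain ⟨b', rfl⟩ : ∃ b', b = b' + 1 := ⟨b - 1, by omega⟩
        rw [pow_zero, one_mul, pow_succ]
        exact Ideal.mul_mem_left _ _ (Ideal.subset_span (by simp))
      · obtain ⟨a', rfl⟩ : ∃ a', a = a' + 1 := ⟨a - 1, by omega⟩
        rw [pow_succ, mul_assoc, mul_comm x, ← mul_assoc]
        exact Ideal.mul_mem_left _ _ (Ideal.subset_span (by simp))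
    exact span_four_move_eq x y z w (Ideal.mul_mem_left _ _ hM) (Ideal.mul_mem_left _ _ hM)
  rw [key _ _ _ (hCle z w hspan), key _ _ _ (hCle _ _ hspan'), hT, hI]

end Summit.ResolutionOfSingularities.ResolutionOfSingularities.Theorems.SwitchingDichotomy.BetaNewton

end
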